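/-
Origin: expansion seat `literature-prover-pub-hodgecm-cf-rogawski-0`, handover v4 2026-08-18 (`HOME/pub-hodgecm-cf-rogawski/StandardInputs.lean`, md5 4c172b40, 82 lines);
landed by the gen-6 packager in gate run 22 as `HodgeCM/Automorphic/StandardInputs.lean` (verbatim).
-/
/-
Copyright: pub-hodgecm formalisation cell (harness21, 2026). New file (not vendored).
Origin: HOME/pub-hodgecm-cf-rogawski/StandardInputs.lean — CITED-FACT seat (4), session
literature-prover-pub-hodgecm-cf-rogawski-0, 2026-08-18T04:3xZ, answering referee 3 R3-6 V6.
Suggested target: `HodgeCM/Automorphic/StandardInputs.lean` (OUTSIDE `HodgeCM/Literature/`).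
-/
import Mathlib

/-!
# STANDARD INPUTS — NOT CITED, NOT CITABLE

This file is NOT part of the citable layer `HodgeCM/Literature/` and its declarations are NOT in the namespace
`HodgeCM.Literature.*`.  It names, with the prefix `Std_`, standard facts of representation theory / class field
theory that the kernel lemmas over the Rogawski carrier (`HodgeCM/Literature/Rogawski.lean`,
`HodgeCM/Literature/RogawskiConsequences.lean`) DISPLAY AS EXPLICIT HYPOTHESES.  Nothing here is asserted, nothing
here carries a `[cite:]` tag, and nothing here may be counted as print under the ABSOLUTE RULE: a consumer who
assumes `(h : Std_… )` has assumed an input, to be classed STD/U (open over print) in `HOME/FACTS.md`, never P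
(referee 3, REFEREE.md R3-6, violation V6; referee 2, R2-13 advisory A1).

The three predicates are stated GENERICALLY (over arbitrary types and functions), so that this file imports only
Mathlib and can be imported by `Literature/Rogawski.lean` itself; the Rogawski files instantiate them at the fields
of the carrier `U3Spectrum` (`IsSquareIntegrable`, `IsTempered`, `lval`, `qCard`, `expo`, `InXi`).

* `Std_sqInt_tempered IsSqInt IsTemp` — "square-integrable ⇒ tempered" for irreducible unitary representations of
  a real reductive group (for the intended meaning see e.g. Borel–Wallach, *Continuous cohomology, discrete
  subgroups, and representations of reductive groups*, 2nd ed. (2000), IV.3.6 (definition of tempered by the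
  bound `|⟨π(g)v,w⟩| ≤ C Ξ(g)`) and IV.3.7 Proposition, (3) ⇒ (1) with `P = G`: a `(𝔤,K)`-module summand of
  `I_{P,σ,ν}` with `σ ∈ 𝓔_d(⁰M)`, `ν ∈ i𝔞*` is tempered — held text `book:borel2000-…` chunk p0117; this
  pointer documents the meaning, it is not a citation claim of this package).
* `Std_heckeCharRigid lval` — two (unitary) Hecke characters whose values on uniformisers agree at all but
  finitely many finite places are equal (weak approximation + continuity; "strong multiplicity one for `GL(1)`").
* `Std_autTwist InXi lval qCard expo act` — `Aut(ℂ)` acts on the algebraic Hecke characters of weight `−1`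
  underlying the pairs `(λ,ν) ∈ Ξ`: for `τ ∈ Aut(ℂ)` there is `λ^τ` with finite part `τ ∘ (λ‖·‖^{-1/2})` and
  infinity type transported by `τ` (CM theory of algebraic Hecke characters: Weil 1955; Serre, *Abelian ℓ-adic
  representations* II-2; Schappacher, LNM 1301 Ch. 0 — UNPLACED here, hence NOT cited).
-/

namespace HodgeCM.StandardInputs

/-- STANDARD INPUT (not cited, not citable): every square-integrable `r` is tempered — generic in a type `L` of
(irreducible unitary) representations and two predicates on it. -/
def Std_sqInt_tempered {L : Type*} (IsSquareIntegrable IsTempered : L → Prop) : Prop :=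
  ∀ r : L, IsSquareIntegrable r → IsTempered r

/-- (Ported verbatim from the HodgeCMPerL package; no docstring in the source.) -/
theorem Std_sqInt_tempered_iff {L : Type*} (IsSquareIntegrable IsTempered : L → Prop) :
    Std_sqInt_tempered IsSquareIntegrable IsTempered ↔ ∀ r : L, IsSquareIntegrable r → IsTempered r := Iff.rfl

/-- STANDARD INPUT (not cited, not citable): rigidity of Hecke characters — generic in a type `H` of characters, a
type `P` of finite places and the "value on a uniformiser" map `lval : H → P → V`: if `lval λ w = lval λ' w` for all
but finitely many `w`, then `λ = λ'`. -/
def Std_heckeCharRigid {H P V : Type*} (lval : H → P → V) : Prop :=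
  ∀ lam lam' : H, {w : P | lval lam w ≠ lval lam' w}.Finite → lam = lam'

/-- (Ported verbatim from the HodgeCMPerL package; no docstring in the source.) -/
theorem Std_heckeCharRigid_iff {H P V : Type*} (lval : H → P → V) :
    Std_heckeCharRigid lval ↔ ∀ lam lam' : H, {w : P | lval lam w ≠ lval lam' w}.Finite → lam = lam' := Iff.rfl

/-- Sanity: rigidity holds whenever `lval` separates characters even modulo finite sets, e.g. trivially when `H` has
at most one element. -/
theorem Std_heckeCharRigid_of_subsingleton {H P V : Type*} [Subsingleton H] (lval : H → P → V) :
    Std_heckeCharRigid lval :=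
  fun lam lam' _ => Subsingleton.elim lam lam'

/-- STANDARD INPUT (not cited, not citable): `Aut(ℂ)`-twists of the Hecke characters `λ` occurring in pairs
`(λ,ν)` with `InXi λ ν` — generic in the character types `H`, `A`, the places `P`, the embeddings `E`, the data
`lval` (value on a uniformiser), `qCard` (residue cardinality), `expo` (archimedean exponent in a given embedding)
and the action `act` of `Aut(ℂ)` on embeddings.  For every `τ` and every such `λ` there is `λ^τ : H` with
(i) `lval λ^τ w · √q_w = τ (lval λ w · √q_w)` at every finite place `w`, and (ii) `expo λ^τ (act τ ρ) = expo λ ρ`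
for every embedding `ρ`. -/
def Std_autTwist {H A P E : Type*} (InXi : H → A → Prop) (lval : H → P → ℂ) (qCard : P → ℕ)
    (expo : H → E → ℤ) (act : (ℂ ≃+* ℂ) → E → E) : Prop :=
  ∀ (τ : ℂ ≃+* ℂ) (lam : H) (nu : A), InXi lam nu →
    ∃ lamτ : H,
      (∀ w : P, lval lamτ w * (Real.sqrt (qCard w) : ℂ) = τ (lval lam w * (Real.sqrt (qCard w) : ℂ))) ∧
      (∀ ρ : E, expo lamτ (act τ ρ) = expo lam ρ)

/-- Sanity (consistency of the shape): the predicate holds vacuously when no pair satisfies `InXi`. -/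
theorem Std_autTwist_of_isEmpty {H A P E : Type*} (InXi : H → A → Prop) (lval : H → P → ℂ) (qCard : P → ℕ)
    (expo : H → E → ℤ) (act : (ℂ ≃+* ℂ) → E → E) (h : ∀ lam nu, ¬ InXi lam nu) :
    Std_autTwist InXi lval qCard expo act :=
  fun _ lam nu hx => (h lam nu hx).elim

end HodgeCM.StandardInputs
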